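import Summits.ResolutionOfSingularities.ResolutionOfSingularities.Theorems.PurelyInseparableDim4InScopeWinCertLeaves
import Summits.ResolutionOfSingularities.ResolutionOfSingularities.Theorems.PurelyInseparableDim4EquimultipleScope
import HarnessLib
import HarnessLib.Audit.Tags

/-!
# Purely inseparable fourfolds — IN-SCOPE WIN CERTIFICATES, FAST CHECKER (Hasse–Taylor equimultiplicity test)
# [OURS · counted 0 · a certificate format for OUR frame v4, not about resolution]

Census cell «res-dim4-pi» (D-0157 DOOR 2), width seat `res-dim4-p-14` (generation 3).  Sequel of
`PurelyInseparableDim4InScopeWinCert` / `…InScopeWinCertLeaves` (`iwinCertB`, `iwinCertBL` and their soundness).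

WHY.  In the kernel (`decide +kernel`) the cost of the row check `irowOK` is dominated by the equimultiplicity test
`StepKit.equiB q S j b s` run at EVERY `K`-rational reply `(j, b)`: it expands the translate `transAll b (chartL q S j s.L)`
into an uncombined term list (length `Σ_monomials ∏ (eᵢ + 1)`, a few hundred entries for degree-8 states) and rescans it for
every entry of degree `< q`.  On the gate lane this put a ceiling of ≈ 8 heavy rows per `decide` (desk WORD #143 (b)).

WHAT.  `equiHB q S j b s` tests equimultiplicity by HASSE–TAYLOR instead: `b` is an equimultiple point of the `x_j`-chart iff
every Hasse derivative `D^{(α)} G`, `0 < |α| < q`, of the chart transform `G` vanishes at `b`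
(`Equimultiple.isEquimultiplePoint_iff_mem_zeroLocus_singLocusIdeal`); on term lists this is
`(idxLT q).all (evalAtL b (hasseL α (chartL q S j s.L)) = 0)` — `|idxLT q|·m` monomial evaluations, no expansion.  Only the
direction «equimultiple ⇒ test passes» is needed for soundness (a reply the test rejects is not an equimultiple point), and that
direction is `mem_zeroLocus` of the generators.  The checkers `iwinCertHB` / `iwinCertHBL` are `iwinCertB` / `iwinCertBL` with
`equiHB` in place of `equiB`; soundness is REDUCED to the landed checkers row by row (`irowOK_of_irowHOK`), so the certified
statement is literally the old one: `InScopeStateWins q row.1.toState` for every row.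

Riders as before: `K`-rational replies over the finite field `K` of the certificate only (NOT ∀K); a statement about OUR frame-v4
game; nothing here proves resolution of singularities in dimension ≥ 4 / characteristic `p`; F4-C(2,2) neither proved nor refuted.
[OURS · counted 0 · AI kernel work, weaker than expert review.]
bears_on: LADDER-RESOLUTION:D157-DOOR2 (res-dim4-pi · F4-C instrument · certificate format). Supports
stmt-ResolutionOfSingularities-16155 (helper).
-/

set_option linter.dupNamespace false

noncomputable section

namespace Summit.ResolutionOfSingularities.ResolutionOfSingularities.Theorems.PIDim4

namespace InScopeWinCert

open MvPolynomial Finset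
open StepKit WinCertSound ScopeBlind ScopeCover
open Literature.AlgebraicGeometry.Resolution
open Literature.AlgebraicGeometry.Resolution.CentreBlowup

variable {K : Type} [Field K] [DecidableEq K]

/-! ## 1. The Hasse–Taylor equimultiplicity test -/

/-- Every multi-index enumerated by `idxLT q` has degree in `(0, q)` (converse of `ScopeCover.mem_idxLT`). [folklore] -/
theorem degree_of_mem_idxLT {q : ℕ} {α : Fin 4 → ℕ} (h : α ∈ idxLT q) : 0 < ∑ i, α i ∧ ∑ i, α i < q := by
  simp only [idxLT, List.mem_flatMap, List.mem_filterMap, List.mem_range] at h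
  obtain ⟨a, -, b, -, c, -, d, -, hd⟩ := h
  split_ifs at hd with hcond
  obtain rfl := Option.some.inj hd
  simpa [Fin.sum_univ_four] using hcond


/-- **Hasse–Taylor equimultiplicity test** at the reply `(j, b)` to the centre `S`: every Hasse derivative `D^{(α)} G`,
`0 < |α| < q`, of the chart transform `G = chartL q S j s.L` vanishes at `b` (term-list evaluation). [folklore] -/
def equiHB (q : ℕ) (S : Finset (Fin 4)) (j : Fin 4) (b : Fin 4 → K) (s : SData 4 K) : Bool :=
  (idxLT q).all fun α => decide (evalAtL b (hasseL α (chartL q S j s.L)) = 0)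

/-- **An equimultiple point passes the Hasse–Taylor test** (the direction the checker needs). [folklore] -/
theorem equiHB_of_isEquimultiplePoint {q : ℕ} {S : Finset (Fin 4)} {j : Fin 4} {b : Fin 4 → K} {s : SData 4 K}
    (h : IsEquimultiplePoint q S j b s.toState) : equiHB q S j b s = true := by
  have hz := (Equimultiple.isEquimultiplePoint_iff_mem_zeroLocus_singLocusIdeal q S j b s.toState).mp h
  rw [MvPolynomial.mem_zeroLocus_iff] at hz
  simp only [equiHB, List.all_eq_true, decide_eq_true_eq]
  intro α hα
  have hdeg := degree_of_mem_idxLT hα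
  have hmem : hasseDeriv (expo α) (chartTransform q S j s.toState.F) ∈
      singLocusIdeal q (chartTransform q S j s.toState.F) :=
    Ideal.subset_span ⟨expo α, by rw [degree_expo]; exact hdeg.1, by rw [degree_expo]; exact hdeg.2, rfl⟩
  have h1 := hz _ hmem
  rw [SData.toState_F, chartTransform_evalT, hasseDeriv_evalT] at h1
  rw [← eval_evalT]
  exact h1

/-- Contrapositive: a reply REJECTED by the Hasse–Taylor test is rejected by the expansion test `equiB`. [folklore] -/
theorem equiB_eq_false_of_equiHB {q : ℕ} {S : Finset (Fin 4)} {j : Fin 4} {b : Fin 4 → K} {s : SData 4 K}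
    (h : equiHB q S j b s = false) : equiB q S j b s = false := by
  rw [Bool.eq_false_iff] at h ⊢
  intro hB
  exact h (equiHB_of_isEquimultiplePoint ((isEquimultiplePoint_iff q S j b s).mpr hB))

/-! ## 2. The fast checkers (closed form and external-leaves form) -/

/-- B's reply `(j, b)` is harmless (fast form): rejected by the Hasse–Taylor test, or kills `F`, or certified later.
[folklore] -/
def ireplyHOK (q : ℕ) (rest : ICert K) (s : SData 4 K) (S : Finset (Fin 4)) (j : Fin 4) (b : Fin 4 → K) : Bool :=
  !(equiHB q S j b s) || StepKit.equivB (stepD q S j b s).L [] || ichildIn rest (stepD q S j b s)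

/-- A fast-harmless reply is harmless. [folklore] -/
theorem ireplyOK_of_ireplyHOK {q : ℕ} {rest : ICert K} {s : SData 4 K} {S : Finset (Fin 4)} {j : Fin 4}
    {b : Fin 4 → K} (h : ireplyHOK q rest s S j b = true) : ireplyOK q rest s S j b = true := by
  unfold ireplyHOK at h
  unfold ireplyOK
  cases hH : equiHB q S j b s with
  | false => rw [equiB_eq_false_of_equiHB hH]; simp
  | true =>
    rw [hH] at h
    simp only [Bool.not_true, Bool.false_or, Bool.or_eq_true] at h
    rcases h with h | h <;> simp [h]

variable [Fintype K]

/-- The row check (fast form): BLIND, or TERMINAL, or a permissible centre all of whose `K`-rational replies are harmless.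
[folklore] -/
def irowHOK (q : ℕ) (rest : ICert K) (row : IRow K) : Bool :=
  blindOK q row || !(permB q Finset.univ row.1.L) ||
    (permB q row.2.1 row.1.L &&
      decide (∀ j ∈ row.2.1, ∀ b : Fin 4 → K, b j = 0 → ireplyHOK q rest row.1 row.2.1 j b = true))

/-- **The fast in-scope win-certificate checker** (children LATER in the list). [folklore] -/
def iwinCertHB (q : ℕ) : ICert K → Bool
  | [] => true
  | row :: rest => irowHOK q rest row && iwinCertHB q rest

/-- **The fast checker with external leaves** (children among the later rows AND the leaf states `L`). [folklore] -/
def iwinCertHBL (q : ℕ) (L : List (SData 4 K)) : ICert K → Bool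
  | [] => true
  | row :: rest => irowHOK q (rest ++ leafRows L) row && iwinCertHBL q L rest

/-! ## 3. Reduction to the landed checkers, soundness -/

/-- A fast-OK row is OK. [folklore] -/
theorem irowOK_of_irowHOK {q : ℕ} {rest : ICert K} {row : IRow K} (h : irowHOK q rest row = true) :
    irowOK q rest row = true := by
  unfold irowHOK at h
  unfold irowOK
  simp only [Bool.or_eq_true, Bool.and_eq_true, Bool.not_eq_true', decide_eq_true_eq] at h ⊢
  rcases h with (hb | ht) | ⟨hp, hr⟩
  · exact Or.inl (Or.inl hb)
  · exact Or.inl (Or.inr ht)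
  · exact Or.inr ⟨hp, fun j hj b hb => ireplyOK_of_ireplyHOK (hr j hj b hb)⟩

/-- **Reduction**: a certificate passing the fast checker passes the landed checker. [folklore] -/
theorem iwinCertB_of_iwinCertHB {q : ℕ} : ∀ {T : ICert K}, iwinCertHB q T = true → iwinCertB q T = true
  | [], _ => rfl
  | row :: rest, h => by
    simp only [iwinCertHB, Bool.and_eq_true] at h
    simp only [iwinCertB, Bool.and_eq_true]
    exact ⟨irowOK_of_irowHOK h.1, iwinCertB_of_iwinCertHB h.2⟩

/-- **Reduction, external-leaves form.** [folklore] -/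
theorem iwinCertBL_of_iwinCertHBL {q : ℕ} {L : List (SData 4 K)} :
    ∀ {T : ICert K}, iwinCertHBL q L T = true → iwinCertBL q L T = true
  | [], _ => rfl
  | row :: rest, h => by
    simp only [iwinCertHBL, Bool.and_eq_true] at h
    simp only [iwinCertBL, Bool.and_eq_true]
    exact ⟨irowOK_of_irowHOK h.1, iwinCertBL_of_iwinCertHBL h.2⟩

/-- **SOUNDNESS OF THE FAST CHECKER**: every row state of a certificate passing `iwinCertHB` is in-scope escapable over the
finite field `K`. [folklore] -/
theorem inScopeStateWins_of_iwinCertHB {q : ℕ} {T : ICert K} (h : iwinCertHB q T = true) :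
    ∀ row ∈ T, InScopeStateWins q row.1.toState :=
  inScopeStateWins_of_iwinCertB (iwinCertB_of_iwinCertHB h)

/-- **SOUNDNESS OF THE FAST CHECKER WITH EXTERNAL LEAVES**: if every leaf state is in-scope escapable, so is every row state
of a certificate passing `iwinCertHBL`. [folklore] -/
theorem inScopeStateWins_of_iwinCertHBL {q : ℕ} {L : List (SData 4 K)} (hL : ∀ s ∈ L, InScopeStateWins q s.toState)
    {T : ICert K} (h : iwinCertHBL q L T = true) : ∀ row ∈ T, InScopeStateWins q row.1.toState :=
  inScopeStateWins_of_iwinCertBL hL (iwinCertBL_of_iwinCertHBL h)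

/-! ## 4. Model -/

/-- The PR-12u model certificate `scopeLossCert` (over `𝔽₂`) passes the fast checker. [OURS · ‖ K] [folklore] -/
theorem iwinCertHB_scopeLossCert : iwinCertHB 2 scopeLossCert = true := by
  decide +kernel

end InScopeWinCert

end Summit.ResolutionOfSingularities.ResolutionOfSingularities.Theorems.PIDim4

end
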